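/-
Origin: expansion seat `planner-pub-hodgecm-mc-axioms-1-g14-0`, handover #W76 2026-08-20T15:53:55Z md5 ca3ffac30124 (PKG d59592835d54 → ca3ffac30124; 526 l.; MECHANICAL (iib-R) rewrite v3.1 of the PKG file as it stands (1 token edits; rules R3x1)) (`HOME/mc/pub-hodgecm-mc-axioms-1-g14/revendor/kit-r55/stage55/HodgeCM/Model/EndStateMeet.lean`, md5 ca3ffac30124, 526 lines);
landed by the gen-22 packager (p-g22) in gate run 55 REPLACES the earlier landed copy of `HodgeCM/Model/EndStateMeet.lean` (seat copy carried the packager Origin header of an earlier run (stripped)).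
-/
/-
Origin: KEPT seat "PerL residual" / END-STATE owner, session `planner-pub-hodgecm-prl1-g11-0` (unit pub-hodgecm-prl1-g11),
2026-08-18.  STAGED as `HOME/pub-hodgecm-prl1-g11/lean/EndStateMeet.lean`; intended final place (packager's call):
`HodgeCM/Model/EndStateMeet.lean`, after `HodgeCM/Model/EndStateLevelMeet.lean`.  ADDITIVE LEAF: one package import,
no existing declaration touched, no new hypothesis of any kind — every statement below is kernel-proved from the package
as it stands (`#print axioms` = `[propext, Classical.choice, Quot.sound]` throughout).
-/
import Summits.HodgeConjecture.HodgeCM.Model.EndStateLevelMeet_2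

/-!
# E4 — the PerL END STATE, MEETING FORM: the theta inputs C5 (`thetaGen12All`) and C6 (`thetaReal34All`)
# re-typed to what Thm 4.4 consumes, level-meeting (E3's C1) absorbed

**Why (HAZARD C5/C6, owner's consumer analysis, same disease as C1 / FIX 1).**  The realisation record types the
wedge-function of two classes on `P_Γ = Γ\𝔹²` (ONE connected quotient: the tree universe's `pms` is the compact
ball quotient of `PicardCM.BallQuotientUniformisedDatum`) as an element `Λ_Γ(ω, ω')` of `HG = L²([G_U])`, the FULL adèlic
quotient.  A class on one connected quotient determines an automorphic function only on ONE `K_Γ`-piece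
`𝒫_Γ = G(ℚ)(G(ℝ) × K_Γ)` (`K_Γ` any compact open subgroup with `G(ℚ) ∩ K_Γ = Γ`), so in the geometric model the
wedge-functions are PIECE-SUPPORTED, whereas the theta lifts `ϑ(χ, Φ)` and the spaces `S₁₂ = S₃₄` live on all of
`[G_U]`.  By strong approximation for `SU(V)`, `𝒫_Γ = det⁻¹(T(ℚ) T(ℝ) det K_Γ)`, `T = U(1)_{L/L⁺}`; the class set
`T(𝔸) / T(ℚ) T(ℝ) det K_Γ` is finite but non-trivial in general (and grows with the level), so:
* C6 as typed — `ϑ₃₄(χ, Φ) ∈ closure (span {Λ_{Γ₂}(ω₃, ω₄)})` — asks a function carried by every `det`-class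
  (translate `Φ` by `g` with `det g` in a prescribed class: the theta kernels are `G(𝔸_f)`-equivariant) to be
  a limit of functions carried by `det⁻¹(T(ℚ) T(ℝ) T(𝒪̂))` only (approximants from all levels): not what PerL's
  Lemma 3.5 (34) says (that lemma concerns products of theta SERIES on `[G_U]`), and false for the genuine core as
  soon as the class group `T(𝔸) / T(ℚ) T(ℝ) T(𝒪̂)` of the torus is non-trivial;
* C5 as typed — `Λ_Γ(ω₁, ω₂) ∈ S₁₂` — asks the piece-restriction `1_{𝒫_Γ} · (θ₁ θ₂)` of a theta lift to lie in the
  closed span `S₁₂` of the (12)-lifts, whereas Lemma 3.5 (12) puts the product `θ₁ θ₂` itself there, not its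
  piece-restriction; since `1_{𝒫_Γ}` is an average of the characters `ν ∘ det` of the class set, C5 amounts to a
  stability of `S₁₂` under these twists — possibly true, not in print, and not needed.
What the proof of Thm 4.4 (`thm44_of_realisation`, Steps 2–3) CONSUMES of C5/C6 is only NON-ORTHOGONALITY:
Step 2 needs "the non-zero wedge `v = Λ_{Γ₁}(ω₁, ω₂)` is not orthogonal to `S₁₂` (= `S₃₄`)", Step 3 needs "if
`v` pairs non-trivially with a generator `ϑ₃₄(χ, Φ)` then it pairs non-trivially with some (34)-wedge-function",
after which E3's level-meeting passes to one level.  Both consumed forms ARE dischargeable for the piece-supported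
model from PerL's Lemma 3.5 in its printed FUNCTION form (products of theta series on `[G_U]`) by one unimodular
substitution — see the roadmap at the end of this docstring — with no condition on class sets.

**What this file does (additive; E3 = `EndStateLevelMeet.lean` is imported and untouched).**
1. `Universe.ThetaRealisation₂` — E3's `ThetaRealisation₁` with `gen12`, `real34`, `Λ_meet` replaced by
   * `gen12Meet : … → Λ Γ ω₁ ω₂ ≠ 0 → ∃ u ∈ S.t12.S12, ⟪Λ Γ ω₁ ω₂, u⟫ ≠ 0` (a non-zero (12)-wedge of theta one-forms
     is not orthogonal to `S₁₂`), and
   * `real34Meet : … allowed χ → … → ω₁ ∈ U_{Ψ₀}(Γ₁) → ω₂ ∈ U_{Ψ₁}(Γ₁) → ⟪Λ Γ₁ ω₁ ω₂, ϑ₃₄ χ Φ⟫ ≠ 0 →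
     ∃ Γ (ω : Fin 4 → H¹(P_Γ)), (∀ i, ω i ∈ U_{Ψ i}(Γ)) ∧ ⟪Λ Γ (ω 2) (ω 3), Λ Γ (ω 0) (ω 1)⟫ ≠ 0`
     (REALITY-MEETING: a (12)-wedge of `U_Ψ`-classes pairing non-trivially with a (34)-theta lift pairs
     non-trivially, AT ONE LEVEL, with a (34)-wedge of `U_Ψ`-classes — C6 and E3's C1 in one dischargeable statement);
   every other field VERBATIM; `ThetaRealisation₁.toMeet₂` (MONOTONICITY: E3's record gives this one — `u := Λ …`
   for `gen12Meet`; `real34` + the closure-span lemma + `Theta_sub` + `Λ_meet` for `real34Meet`);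
   `ModelAxiomsPerL.thm44_of_realisation₂` — Thm 4.4 over the new record (Steps 1, 5, 6 verbatim; Steps 2–4 are now
   two field applications around the isolation identity `S₁₂ = S₃₄`, which is STILL consumed here).
2. `ThetaModel.Gen12MeetAt V c` (generator form: `∃ χ Φ, ⟪Λ Γ ω₁ ω₂, ϑ₁₂ χ Φ⟫ ≠ 0`), `ThetaModel.Real34MeetAt V c`,
   the pointwise record `ThetaModel.AllCharsNonDesignPt₂ S` with SIX inputs {C2 `innerEmb`, C3 `thetaSub`,
   C4 `thetaWedge`, C5′ `gen12Meet`, C6′ `real34Meet`, C7 `occ`} (no C1 of any form), and MONOTONICITY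
   `AllCharsNonDesignPt₁.toMeet₂ : AllCharsNonDesignPt₁ S → AllCharsNonDesignPt₂ S` (so E3, E2″, E2′, E2 all factor).
3. The PerL path: `RealisationExistsPerL₂`, `perL₂`, `nonempty_thetaRealisation₂_at(_allChars)`,
   `realisationExistsPerL₂_of_pt`, `perL_of_pt₂`, the typed hypotheses `ThetaModelExistsPt₂ S`,
   `ThetaModelExists_sextic₂`, and the headline
   `Assembly.perL_ofSignRecipe₁₀ (M : U.ModelAxiomsPerL) (h) (C) (d12 d34) (hS : sextic ⊆ S)
   (A : (C.thetaModel h d12 d34).AllCharsNonDesignPt₂ S) (hHR) : U.PerL` — the term the E seat instantiates —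
   with `perL_of_thetaModelExists_sextic₂` and the closing `example`s (₉, hence ₈, ₇'', ₇', ₇, are cases of ₁₀).
   The face setting (`RealisationExistsFace`) is not on the PerL path and is not re-derived here (E3 carries it).

ROADMAP FOR THE INSTANCE SEAT (not used in this file; corrects one remark of E3's roadmap).  Fix for every level
`Γ` ONE compact open `K_Γ ≤ G(𝔸_f)` with `G(ℚ) ∩ K_Γ = Γ` (possible because `Level` means torsion-free CONGRUENCE
subgroup, `HodgeCM.Level.isCongruence`; e.g. `K_Γ = Γ · K(m)` for `Γ(m) ≤ Γ`, and `K_{Γ(m)} = K(m)`; NOT "the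
closure of `Γ`", which is compact but not open — `det Γ` is finite; E3's word "saturated" should be read this way),
`𝒫_Γ := G(ℚ)(G(ℝ) × K_Γ) ≅ Γ\(G(ℝ) × K_Γ)`, `emb_Γ η := c_Γ ·` (the right-`K_Γ`-invariant lift to `𝒫_Γ` of the
function of the harmonic representative of `η`, extended by zero), theta one-forms at `Γ` := the restrictions
`h_∞ ↦ θ(χ, Φ)(h_∞, 1)` of theta SERIES whose Schwartz datum is `ω(K_Γ)`-fixed — so that `emb_Γ` of such a form is
`c_Γ · 1_{𝒫_Γ} · θ(χ, Φ)` and `Λ_Γ(ω₁, ω₂) = c_Γ · 1_{𝒫_Γ} · θ₁ θ₂` ON THE NOSE (the wedge of two such forms of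
types pairing into `F²` is the harmonic product form).  Every series is of this kind at the principal levels
`Γ(m)`, `m ≫ 0`, and after a finite-adèlic translation of its datum it is non-zero on `𝒫_{Γ(m)}` (the `det`-classes
are permuted transitively by translations) — which is how C4 is met.  Every pairing below is `vol(K) × ∫_{Γ'\G(ℝ)}`
of functions on some `Γ'\G(ℝ)`, so the choice of the `K`'s only moves volume factors into C2's per-level constants.
* C5′: for theta one-forms `ω₁, ω₂` at `Γ` let `Ṽ := θ₁ θ₂ ∈ L²([G_U])` be the product of the two series; by
  Lemma 3.5 (12) (seesaw, split data) `Ṽ = ϑ₁₂(χ₁χ₂, Φ₁ ⊗ Φ₂)` IS a generator, and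
  `⟪Λ_Γ(ω₁, ω₂), Ṽ⟫ = conj c_Γ · ∫_{𝒫_Γ} |Ṽ|²`, non-zero exactly when `Λ_Γ(ω₁, ω₂) = c_Γ · 1_{𝒫_Γ} Ṽ ≠ 0`.
* C6′: `⟪v, ϑ₃₄(χ, Φ)⟫ ≠ 0` with `v = Λ_{Γ₁}(ω₁, ω₂)` right-`K₁`-invariant (`K₁ = K_{Γ₁}`) and carried by
  `𝒫_{Γ₁}`; Lemma 3.5 (34) in function form: `ϑ₃₄(χ, Φ)` is an `L²`-limit of sums of products `P = θ₃ θ₄` of theta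
  series of the two (34) lines, so `⟪v, P⟫ ≠ 0` for one such `P`, with `ω(K_P)`-fixed data for some compact open
  `K_P`; split `𝒫_{Γ₁}` into its finitely many `K₁ ∩ K_P`-pieces `G(ℚ)(G(ℝ) × k (K₁ ∩ K_P))`, `k ∈ K₁`; on a
  piece with non-zero contribution substitute `g = h k`: by right-`K₁`-invariance of `v` the contribution is
  `∫_{𝒫'} conj (v h) · (R(k) P)(h) dh` over the piece `𝒫' = G(ℚ)(G(ℝ) × K')`, `K' = K₁ ∩ k K_P k⁻¹`, whose
  rational points `Γ' = G(ℚ) ∩ K' ≤ Γ₁` form a `Level V`; both factors are right-`K'`-invariant, `v` is `c₁ ×` the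
  lift of the function of `cover^*(ω₁ ∪ ω₂)` (`cover : P_{Γ'} → P_{Γ₁}`), and
  `R(k) P = θ(χ₃, ω(k)Φ₃) · θ(χ₄, ω(k)Φ₄)` has `ω(K')`-fixed data, so it restricts on `Γ'\G(ℝ)` to the function
  of `ω₃' ∪ ω₄'` for the two restricted ONE-FORMS `ω₃', ω₄'` at `Γ'`; hence the contribution is
  `vol(K') ∫_{Γ'\G(ℝ)} conj(c₁ f₁₂) f₃₄`, and `⟪Λ_{Γ'}(cover^*ω₁, cover^*ω₂), Λ_{Γ'}(ω₃', ω₄')⟫ =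
  |c_{Γ'}|² vol(K_{Γ'}) ∫_{Γ'\G(ℝ)} conj f₁₂ · f₃₄` is a non-zero multiple of it.  Memberships:
  `cover^*ωᵢ ∈ U_{Ψᵢ}(Γ')` by `Universe.pullC_mem_Uiso` (`Fact_pull_comp`), and
  `Λ_{Γ'}(cover^*ω₁, cover^*ω₂) = emb_{Γ'}(cover^*(ω₁ ∪ ω₂))` by `Fact_pull_cup`; `ω₃' ∈ U_{Ψ₂}(Γ')`,
  `ω₄' ∈ U_{Ψ₃}(Γ')` by the membership lemma behind C3 (a restricted theta series of type `Ψ` has the Hodge type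
  of `Ψ`, at any level it is invariant under) — `real34Meet` asks only `U_Ψ`-membership at `Γ'`, not membership
  in the model's `Θ(Γ')`, so no compatibility between `K_{Γ'}` and `K'` is needed.  No tower identity, no
  condition on class sets, no Hecke translate on forms (the translation acts on the Schwartz datum), no new print
  field; glue-1's J2d/J2e laws (`pieceEmb` restrict / decompose / `R_pieceEmb` translate) are these steps in `Q.H`.
-/

noncomputable section

open scoped TensorProduct InnerProductSpace Matrix

namespace HodgeCM

open Literature.AlgebraicGeometry.Motives (CMType HodgeStructure)
open Literature.AlgebraicGeometry.Motives.HodgeStructure (conj)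
open HodgeCM.Prior.Perl34File

namespace Universe

variable (U : Universe)

/-! ## 1. The realisation record, meeting form -/

/-- **Theta realisation data, meeting form**: E3's `ThetaRealisation₁` with `gen12`, `real34`, `Λ_meet` replaced by
`gen12Meet` (a non-zero (12)-wedge of theta one-forms is not orthogonal to `S₁₂`) and `real34Meet` (a (12)-wedge of
`U_Ψ`-classes that pairs non-trivially with a (34)-theta lift pairs non-trivially, at ONE level, with a (34)-wedge
of `U_Ψ`-classes); every other field VERBATIM. -/
structure ThetaRealisation₂ {L : CMField} (ι₁ : L →+* ℂ) (V : HermSpace3 L ι₁)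
    (K : CMField) (Ψ : Fin 4 → CMType K) (σ : K →+* ℂ) where
  H : Type
  HG : Type
  CG : Type
  G : Type
  SK : Type
  SigIdx : Type
  SigIdxG : Type
  [i1 : NormedAddCommGroup H] [i2 : InnerProductSpace ℂ H] [i3 : CompleteSpace H]
  [i4 : NormedAddCommGroup HG] [i5 : InnerProductSpace ℂ HG] [i6 : CompleteSpace HG]
  [i7 : NormedAddCommGroup CG] [i8 : NormedSpace ℂ CG]
  [i9 : Group G] [i10 : TopologicalSpace G] [i11 : TopologicalSpace SK]
  S : Perl34.IsolationSetting H HG CG G SK SigIdx SigIdxG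
  Λ : ∀ Γ : Level V, U.CohC (U.pms L ι₁ V Γ) 1 →ₗ[ℂ] U.CohC (U.pms L ι₁ V Γ) 1 →ₗ[ℂ] HG
  Theta : Fin 4 → ∀ Γ : Level V, Set (U.CohC (U.pms L ι₁ V Γ) 1)
  Theta_sub : ∀ (i : Fin 4) (Γ : Level V), Theta i Γ ⊆ U.Uiso Γ K (Ψ i) σ
  lineField : ∃ Γ : Level V, ∃ ω₁ ∈ Theta 0 Γ, ∃ ω₂ ∈ Theta 1 Γ, Λ Γ ω₁ ω₂ ≠ 0
  /-- **C5′ (GEN12-MEETING)**: a non-zero wedge-function of theta one-forms of types `(Ψ₀, Ψ₁)` is not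
  orthogonal to `S₁₂` (what Step 2 of Thm 4.4 consumes of Lemma 3.5 (12)). -/
  gen12Meet : ∀ (Γ : Level V) (ω₁ ω₂ : U.CohC (U.pms L ι₁ V Γ) 1),
    ω₁ ∈ Theta 0 Γ → ω₂ ∈ Theta 1 Γ → Λ Γ ω₁ ω₂ ≠ 0 → ∃ u ∈ S.t12.S12, ⟪Λ Γ ω₁ ω₂, u⟫_ℂ ≠ 0
  /-- **C6′ (REALITY-MEETING)**: a wedge-function of `U_Ψ`-classes of types `(Ψ₀, Ψ₁)` that pairs non-trivially
  with a generator `ϑ₃₄(χ, Φ)` of `S₃₄` pairs non-trivially, at ONE level, with a wedge-function of `U_Ψ`-classes of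
  types `(Ψ₂, Ψ₃)` (what Steps 3–4 of Thm 4.4 consume of Lemma 3.5 (34) and of the change of level). -/
  real34Meet : ∀ χ : S.t34.X, S.t34.allowed χ → ∀ (Φ : SK) (Γ₁ : Level V) (ω₁ ω₂ : U.CohC (U.pms L ι₁ V Γ₁) 1),
    ω₁ ∈ U.Uiso Γ₁ K (Ψ 0) σ → ω₂ ∈ U.Uiso Γ₁ K (Ψ 1) σ → ⟪Λ Γ₁ ω₁ ω₂, S.t34.ϑ χ Φ⟫_ℂ ≠ 0 →
    ∃ (Γ : Level V) (ω : Fin 4 → U.CohC (U.pms L ι₁ V Γ) 1),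
      (∀ i, ω i ∈ U.Uiso Γ K (Ψ i) σ) ∧ ⟪Λ Γ (ω 2) (ω 3), Λ Γ (ω 0) (ω 1)⟫_ℂ ≠ 0
  inner_Λ : ∀ Γ : Level V, ∃ c : ℂ, c ≠ 0 ∧ ∀ ω : Fin 4 → U.CohC (U.pms L ι₁ V Γ) 1,
    (∀ i, ω i ∈ U.H10 (U.pms L ι₁ V Γ)) →
      ⟪Λ Γ (ω 2) (ω 3), Λ Γ (ω 0) (ω 1)⟫_ℂ = c * U.period (U.pms L ι₁ V Γ) ω

attribute [instance] ThetaRealisation₂.i1 ThetaRealisation₂.i2 ThetaRealisation₂.i3 ThetaRealisation₂.i4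
  ThetaRealisation₂.i5 ThetaRealisation₂.i6 ThetaRealisation₂.i7 ThetaRealisation₂.i8 ThetaRealisation₂.i9
  ThetaRealisation₂.i10 ThetaRealisation₂.i11

variable {U}

/-- **MONOTONICITY at the realisation level**: E3's level-meeting record gives the meeting record — `gen12Meet`
with `u :=` the wedge itself (`gen12`), `real34Meet` from `real34`, the closure-span lemma, `Theta_sub` and
`Λ_meet` (= Steps 3–4 of `thm44_of_realisation₁`). -/
def ThetaRealisation₁.toMeet₂ {L : CMField} {ι₁ : L →+* ℂ} {V : HermSpace3 L ι₁}
    {K : CMField} {Ψ : Fin 4 → CMType K} {σ : K →+* ℂ} (R : U.ThetaRealisation₁ ι₁ V K Ψ σ) :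
    U.ThetaRealisation₂ ι₁ V K Ψ σ where
  H := R.H
  HG := R.HG
  CG := R.CG
  G := R.G
  SK := R.SK
  SigIdx := R.SigIdx
  SigIdxG := R.SigIdxG
  S := R.S
  Λ := R.Λ
  Theta := R.Theta
  Theta_sub := R.Theta_sub
  lineField := R.lineField
  gen12Meet := fun Γ ω₁ ω₂ e₁ e₂ hne => ⟨R.Λ Γ ω₁ ω₂, R.gen12 Γ ω₁ ω₂ e₁ e₂, inner_self_ne_zero.mpr hne⟩
  real34Meet := by
    intro χ hχ Φ Γ₁ ω₁ ω₂ e₁ e₂ hne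
    obtain ⟨u, ⟨Γ₂, ω₃, hω₃, ω₄, hω₄, rfl⟩, hu⟩ :=
      StubTree.exists_inner_ne_zero_of_mem_closure_span hne (R.real34 χ hχ Φ)
    have hu' : ⟪R.Λ Γ₂ ω₃ ω₄, R.Λ Γ₁ ω₁ ω₂⟫_ℂ ≠ 0 := by
      intro h0
      apply hu
      rw [← inner_conj_symm, h0, map_zero]
    exact R.Λ_meet Γ₁ Γ₂ ω₁ ω₂ ω₃ ω₄ e₁ e₂ (R.Theta_sub 2 Γ₂ hω₃) (R.Theta_sub 3 Γ₂ hω₄) hu'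
  inner_Λ := R.inner_Λ

/-- The record of record gives the meeting record (over `Fact_pull_comp`). -/
def ThetaRealisation.toMeet₂ (hpc : U.Fact_pull_comp) {L : CMField} {ι₁ : L →+* ℂ} {V : HermSpace3 L ι₁}
    {K : CMField} {Ψ : Fin 4 → CMType K} {σ : K →+* ℂ} (R : U.ThetaRealisation ι₁ V K Ψ σ) :
    U.ThetaRealisation₂ ι₁ V K Ψ σ :=
  (R.toMeet hpc).toMeet₂

namespace ModelAxiomsPerL

/-! ## 2. Thm 4.4 over the meeting record -/

/-- **PerL Thm 4.4's conclusion `PeriodNV` from a meeting realisation**, over `pull_hodge` only.  Step 1 (Prop 4.3),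
Step 5 (Petersson = period), Step 6 (multilinear expansion) verbatim from `thm44_of_realisation`; Steps 2–4 are:
`gen12Meet` (the wedge is not orthogonal to `S₁₂`), the isolation identity `S₁₂ = S₃₄` (`IsolationSetting.C2_S12_eq_S34`,
Thm 3.7) and the closure-span lemma (so the wedge pairs with a generator `ϑ₃₄(χ, Φ)`), `real34Meet`. -/
theorem thm44_of_realisation₂ (M : U.ModelAxiomsPerL) {L : CMField} {ι₁ : L →+* ℂ}
    {V : HermSpace3 L ι₁} {K : CMField} {Ψ : Fin 4 → CMType K} {σ : K →+* ℂ}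
    (R : U.ThetaRealisation₂ ι₁ V K Ψ σ) : U.PeriodNV ι₁ V K Ψ σ := by
  classical
  -- Step 1: a nonzero (12)-wedge of theta one-forms at some level Γ₁ (Prop 4.3)
  obtain ⟨Γ₁, ω₁, hω₁, ω₂, hω₂, hv⟩ := R.lineField
  -- Step 2′: it is not orthogonal to S₁₂ = S₃₄, hence pairs non-trivially with some generator ϑ₃₄(χ, Φ)
  obtain ⟨u, huS, hu⟩ := R.gen12Meet Γ₁ ω₁ ω₂ hω₁ hω₂ hv
  rw [R.S.C2_S12_eq_S34, R.S.t34.S12_def] at huS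
  obtain ⟨w, ⟨χ, hχ, Φ, rfl⟩, hw⟩ := StubTree.exists_inner_ne_zero_of_mem_closure_span hu huS
  -- Steps 3′–4′: reality-meeting
  obtain ⟨Γ, ω, hU, hinner⟩ :=
    R.real34Meet χ hχ Φ Γ₁ ω₁ ω₂ (R.Theta_sub 0 Γ₁ hω₁) (R.Theta_sub 1 Γ₁ hω₂) hw
  -- Step 5: Petersson pairing = period (all four classes are holomorphic one-forms)
  obtain ⟨c, -, hcΛ⟩ := R.inner_Λ Γ
  have hper : U.period (U.pms L ι₁ V Γ) ω ≠ 0 := by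
    have h := hcΛ ω (fun i => Universe.Uiso_le_H10 M.pull_hodge Γ K (Ψ i) σ (hU i))
    intro h0
    rw [h0, mul_zero] at h
    exact hinner h
  -- Step 6: multilinear expansion to pure pullbacks
  exact Universe.periodNV_of_period_ne_zero Γ ω hU hper

end ModelAxiomsPerL

/-! ## 3. The meeting inputs of a theta model, pointwise, and the six-input record -/

namespace ThetaModel

variable (T : U.ThetaModel)

/-- **C5′ GEN12-MEETING AT `(V, c)`**, all-characters generator form: a non-zero wedge-function of theta one-forms
of types `(Ψ₀, Ψ₁)` at some level pairs non-trivially with some theta lift `ϑ₁₂(χ, Φ)`. -/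
def Gen12MeetAt {L : CMField} {ι₁ : L →+* ℂ} (V : HermSpace3 L ι₁) (c : SeesawCtx L) : Prop :=
  ∀ (Γ : Level V) (ω₁ ω₂ : U.CohC (U.pms L ι₁ V Γ) 1), ω₁ ∈ T.Theta V c 0 Γ → ω₂ ∈ T.Theta V c 1 Γ →
    T.Λ Γ ω₁ ω₂ ≠ 0 → ∃ (χ : (T.t12 V c).X) (Φ : T.SK V c), ⟪T.Λ Γ ω₁ ω₂, (T.t12 V c).ϑ χ Φ⟫_ℂ ≠ 0

/-- **C6′ REALITY-MEETING AT `(V, c)`**: a wedge-function of `U_Ψ`-classes of types `(Ψ₀, Ψ₁)` at `Γ₁` that pairs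
non-trivially with a theta lift `ϑ₃₄(χ, Φ)` pairs non-trivially, at ONE level `Γ`, with a wedge-function of
`U_Ψ`-classes of types `(Ψ₂, Ψ₃)` at `Γ`.  Mentions `T` through `T.emb` (in `T.Λ`) and the (34)-theta lifts only. -/
def Real34MeetAt {L : CMField} {ι₁ : L →+* ℂ} (V : HermSpace3 L ι₁) (c : SeesawCtx L) : Prop :=
  ∀ (χ : (T.t34 V c).X) (Φ : T.SK V c) (Γ₁ : Level V) (ω₁ ω₂ : U.CohC (U.pms L ι₁ V Γ₁) 1),
    ω₁ ∈ U.Uiso Γ₁ c.K (c.Ψ 0) c.σ → ω₂ ∈ U.Uiso Γ₁ c.K (c.Ψ 1) c.σ →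
    ⟪T.Λ Γ₁ ω₁ ω₂, (T.t34 V c).ϑ χ Φ⟫_ℂ ≠ 0 →
    ∃ (Γ : Level V) (ω : Fin 4 → U.CohC (U.pms L ι₁ V Γ) 1),
      (∀ i, ω i ∈ U.Uiso Γ c.K (c.Ψ i) c.σ) ∧ ⟪T.Λ Γ (ω 2) (ω 3), T.Λ Γ (ω 0) (ω 1)⟫_ℂ ≠ 0

/-- MONOTONICITY, C5 ⟹ C5′ at `(V, c)`: if the wedge lies in the closed span of the (12)-theta lifts and is non-zero,
it pairs non-trivially with one of them. -/
theorem gen12MeetAt_of_thetaGen12All {L : CMField} {ι₁ : L →+* ℂ} (V : HermSpace3 L ι₁) (c : SeesawCtx L)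
    (h₇ : ∀ (Γ : Level V) (ω₁ ω₂ : U.CohC (U.pms L ι₁ V Γ) 1), ω₁ ∈ T.Theta V c 0 Γ → ω₂ ∈ T.Theta V c 1 Γ →
      T.Λ Γ ω₁ ω₂ ∈ (Submodule.span ℂ
        {u : T.HG L ι₁ V | ∃ (χ : (T.t12 V c).X) (Φ : T.SK V c), u = (T.t12 V c).ϑ χ Φ}).topologicalClosure) :
    T.Gen12MeetAt V c := by
  intro Γ ω₁ ω₂ e₁ e₂ hne
  obtain ⟨u, ⟨χ, Φ, rfl⟩, hu⟩ :=
    StubTree.exists_inner_ne_zero_of_mem_closure_span (inner_self_ne_zero.mpr hne) (h₇ Γ ω₁ ω₂ e₁ e₂)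
  exact ⟨χ, Φ, hu⟩

/-- MONOTONICITY, C6 ∧ C3 ∧ (E3's C1 = level-meeting) ⟹ C6′ at `(V, c)`. -/
theorem real34MeetAt_of_thetaReal34All {L : CMField} {ι₁ : L →+* ℂ} (V : HermSpace3 L ι₁) (c : SeesawCtx L)
    (h₁ : T.LevelMeetAt V c) (h₅ : ∀ (i : Fin 4) (Γ : Level V), T.Theta V c i Γ ⊆ U.Uiso Γ c.K (c.Ψ i) c.σ)
    (h₈ : ∀ (χ : (T.t34 V c).X) (Φ : T.SK V c),
      (T.t34 V c).ϑ χ Φ ∈ (Submodule.span ℂ (T.wedgeSet V c 2 3)).topologicalClosure) :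
    T.Real34MeetAt V c := by
  intro χ Φ Γ₁ ω₁ ω₂ e₁ e₂ hne
  obtain ⟨u, ⟨Γ₂, ω₃, hω₃, ω₄, hω₄, rfl⟩, hu⟩ := StubTree.exists_inner_ne_zero_of_mem_closure_span hne (h₈ χ Φ)
  have hu' : ⟪T.Λ Γ₂ ω₃ ω₄, T.Λ Γ₁ ω₁ ω₂⟫_ℂ ≠ 0 := by
    intro h0
    apply hu
    rw [← inner_conj_symm, h0, map_zero]
  exact h₁ Γ₁ Γ₂ ω₁ ω₂ ω₃ ω₄ e₁ e₂ (h₅ 2 Γ₂ hω₃) (h₅ 3 Γ₂ hω₄) hu'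

/-- **THE POINTWISE RECORD, MEETING FORM, on the class `S`** — SIX inputs, each demanded only at good contexts of
the class `S` and at the hermitian space at hand: C2 `innerEmb` (the Petersson identity at `V`), C3 `thetaSub`,
C4 `thetaWedge` (Prop 4.3 on forms), C5′ `gen12Meet`, C6′ `real34Meet`, C7 `occ`.  No level-change input of any form. -/
structure AllCharsNonDesignPt₂ (S : ∀ {L : CMField}, SeesawCtx L → Prop) : Prop where
  innerEmb : ∀ {L : CMField} {ι₁ : L →+* ℂ} (V : HermSpace3 L ι₁) (c : SeesawCtx L), T.GoodCtx ι₁ c → S c → T.InnerEmbAt V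
  thetaSub : ∀ {L : CMField} {ι₁ : L →+* ℂ} (V : HermSpace3 L ι₁) (c : SeesawCtx L), T.GoodCtx ι₁ c → S c →
    ∀ (i : Fin 4) (Γ : Level V), T.Theta V c i Γ ⊆ U.Uiso Γ c.K (c.Ψ i) c.σ
  thetaWedge : ∀ {L : CMField} {ι₁ : L →+* ℂ} (V : HermSpace3 L ι₁) (c : SeesawCtx L), T.GoodCtx ι₁ c → S c →
    ∃ Γ : Level V, ∃ ω₁ ∈ T.Theta V c 0 Γ, ∃ ω₂ ∈ T.Theta V c 1 Γ, U.cup2C (U.pms L ι₁ V Γ) 1 ω₁ ω₂ ≠ 0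
  gen12Meet : ∀ {L : CMField} {ι₁ : L →+* ℂ} (V : HermSpace3 L ι₁) (c : SeesawCtx L), T.GoodCtx ι₁ c → S c →
    T.Gen12MeetAt V c
  real34Meet : ∀ {L : CMField} {ι₁ : L →+* ℂ} (V : HermSpace3 L ι₁) (c : SeesawCtx L), T.GoodCtx ι₁ c → S c →
    T.Real34MeetAt V c
  occ : ∀ {L : CMField} {ι₁ : L →+* ℂ} (V : HermSpace3 L ι₁) (c : SeesawCtx L), T.GoodCtx ι₁ c → S c →
    (∀ (Φ : T.SK V c) (i : T.SigIdx V c),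
        (∃ v ∈ (T.core V c).hatσ i, (T.core V c).TΦ Φ v ≠ 0) → (T.t12 V c).wOccurs i) ∧
      (∀ (Φ : T.SK V c) (i : T.SigIdx V c),
        (∃ v ∈ (T.core V c).hatσ i, (T.core V c).TΦ Φ v ≠ 0) → (T.t34 V c).wOccurs i)

variable {T}

/-- **MONOTONICITY**: E3's pointwise record gives the meeting record (so do, through it, E2″ / E2′ / E2). -/
theorem AllCharsNonDesignPt₁.toMeet₂ {S : ∀ {L : CMField}, SeesawCtx L → Prop} (A : T.AllCharsNonDesignPt₁ S) :
    T.AllCharsNonDesignPt₂ S :=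
  ⟨A.innerEmb, A.thetaSub, A.thetaWedge,
    fun V c hc hS => T.gen12MeetAt_of_thetaGen12All V c (A.thetaGen12All V c hc hS),
    fun V c hc hS => T.real34MeetAt_of_thetaReal34All V c (A.levelMeet V c hc hS) (A.thetaSub V c hc hS)
      (A.thetaReal34All V c hc hS),
    A.occ⟩

/-- E2″'s record gives the meeting record (over `Fact_pull_comp`, `Fact_pull_cup`). -/
theorem AllCharsNonDesignPt.toMeet₂ (hpc : U.Fact_pull_comp) (hcup : U.Fact_pull_cup)
    {S : ∀ {L : CMField}, SeesawCtx L → Prop} (A : T.AllCharsNonDesignPt S) : T.AllCharsNonDesignPt₂ S :=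
  (A.toLevelMeet hpc hcup).toMeet₂

/-- Restriction of the meeting record to a smaller class. -/
theorem AllCharsNonDesignPt₂.mono {S S' : ∀ {L : CMField}, SeesawCtx L → Prop}
    (hSS' : ∀ {L : CMField} (c : SeesawCtx L), S' c → S c) (A : T.AllCharsNonDesignPt₂ S) :
    T.AllCharsNonDesignPt₂ S' :=
  ⟨fun V c hc h => A.innerEmb V c hc (hSS' c h), fun V c hc h => A.thetaSub V c hc (hSS' c h),
    fun V c hc h => A.thetaWedge V c hc (hSS' c h), fun V c hc h => A.gen12Meet V c hc (hSS' c h),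
    fun V c hc h => A.real34Meet V c hc (hSS' c h), fun V c hc h => A.occ V c hc (hSS' c h)⟩

end ThetaModel

/-! ## 4. The realisation open input, meeting form, and the PerL path from the pointwise record -/

variable (U) in
/-- `RealisationExistsPerL` (`StubTree/Inputs.lean:82`) with `ThetaRealisation₂` for `ThetaRealisation`. -/
def RealisationExistsPerL₂ : Prop :=
  ∀ (K L : CMField) (j : K →+* L), IsNormalClosure ℚ K L →
    Module.finrank ℚ K = 6 → (Module.finrank ℚ L = 24 ∨ Module.finrank ℚ L = 48) →
    ∀ (φ : Fin 3 → (K →+* ℂ)), IsFrame φ →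
    ∀ (ι₁ : L →+* ℂ), ι₁.comp j = φ 0 →
    ∀ (t : Fin 4 → CMType K), IsPerLTypes φ t →
    ∀ (V : HermSpace3 L ι₁), Nonempty (U.ThetaRealisation₂ ι₁ V K t (φ 0))

/-- MONOTONICITY: E3's open input gives the meeting one. -/
theorem RealisationExistsPerL₁.toMeet₂ (h : U.RealisationExistsPerL₁) : U.RealisationExistsPerL₂ :=
  fun K L j hN hK hL φ hφ ι₁ hι t ht V => ⟨(Classical.choice (h K L j hN hK hL φ hφ ι₁ hι t ht V)).toMeet₂⟩

namespace ModelAxiomsPerL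

/-- PerL Thm 4.4 from the meeting open input. -/
theorem perL44_holds₂ (M : U.ModelAxiomsPerL) (hR : U.RealisationExistsPerL₂) : U.PerL44 := by
  intro K L j hN hK hL φ hφ ι₁ hι t ht V
  obtain ⟨R⟩ := hR K L j hN hK hL φ hφ ι₁ hι t ht V
  exact thm44_of_realisation₂ M R

/-- **`W_per^L` from the meeting open input** (Landherr existence in-package, `StubTree.landherr_exists`). -/
theorem perL₂ (M : U.ModelAxiomsPerL) (hR : U.RealisationExistsPerL₂) : U.PerL :=
  Assembly.perL_of_perL44 U StubTree.landherr_exists (perL44_holds₂ M hR)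


-- port_pkg: scope closed for this part
end ModelAxiomsPerL
end Universe
end HodgeCM
end
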